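import Summits.BirchSwinnertonDyer.Rank1Residual.P2.CongruentNumberThetaStarTowersBSD
import Summits.BirchSwinnertonDyer.Rank1Residual.P2.CongruentNumberThetaStarSilent
import HarnessLib
import HarnessLib.Audit.Tags

/-!
# Cell «bsd-monsky» (prover-B): 𝒮⁻-TOWERS — the silence of Tian–Yuan–Zhang's Theorem 1.2 on the Legendre symbols, and the joint
# statement «TYZ-silent ∧ ord_{s=1} L = 1 ∧ rank 1 ∧ Ш[2^∞] = 0 ∧ BSD(E, 2)» for every tower over every pair of `𝒮⁻` (kernel theorem; nothing asserted)

HONEST FRAMING (cell `bsd-monsky`, run/shared/lean/pub/bsd-monsky/; README §1/§3): «ℓ ≥ 3 rungs are NOT claimed — record what the same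
argument gives there, no more». `…ThetaStarSilent` proves `even_genusSum₂'_tower` (TYZ's printed `Σ₂′(n)` is even on the one-mark towers)
with the hypotheses in `kroneckerBit` form; `…ThetaStarTowersBSD` proves THE 𝒮⁻-TOWER THEOREM `rankOne_sha_bsdp_two_sminus_tower` on the
Legendre symbols. THIS FILE states the silence on the Legendre symbols for a tower `2·q·p·p₁⋯p_m` over a pair `(p, q) ∈ 𝒮⁻`
(`even_genusSum₂'_sminus_tower`, modulo Rédei–Reichardt only) and the conjunction (`silent_and_bsdp_two_sminus_tower`): for `(p, q) ∈ 𝒮⁻` —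
`p ≡ 5 (mod 8)`, `q ≡ 3 (mod 4)`, `(p/q) = −1` — and further distinct primes `p₁, …, p_m ≡ 5 (mod 8)` with `(pᵢ/q) = (pᵢ/p) = (pⱼ/pᵢ) = +1`,
the number `n = 2·q·p·p₁⋯p_m` is one on which Tian–Yuan–Zhang's Thm. 1.2 says nothing (`Σ₂′(n)` even), and `ord_{s=1} L(E_n, s) = 1`, rank
`E_n(ℚ) = 1`, `Ш(E_n)[2^∞] = 0`, `BSD(E_n, 2)` — for every `m ≥ 0`, relative to {`tyz_cmPointGaloisData`, `thm11_parity_of_scriptL`, GZK,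
`monsky_card_selmerGroup_two_even`}. CONDITIONAL on the named facts said; nothing asserted; no count moves; no class booked. NOT refereed;
not part of PROOF-B v1.3 or of the paper.

References: [TianYuanZhang2017] Thm. 1.2 (p0002 L115–L127); [Monsky1990MockHeegner] p. 67 Remark (3); [IrelandRosen1990] Ch. 5 §1
Prop. 5.1.2, §2 Thm. 2; [LiMa2008] Thm. 0.4; HOME/proof/PROOF-B-THETA-STAR.md §7–§9.
-/

noncomputable section

open scoped Classical

open Matrix Finset WeierstrassCurve Literature.NumberTheory.EllipticCurves
  Literature.NumberTheory.EllipticCurves.Rank1Residual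
  Literature.NumberTheory.EllipticCurves.Rank1Residual.Typed
  Literature.NumberTheory.EllipticCurves.HeathBrown1994
  Literature.NumberTheory.EllipticCurves.TianYuanZhang2017
  Literature.NumberTheory.EllipticCurves.TianYuanZhang2017.W2
  Literature.NumberTheory.QuadraticFields.RedeiReichardt

set_option autoImplicit false

namespace Summit.BirchSwinnertonDyer.Rank1Residual.P2

namespace ThetaDescent

/-- **TYZ's Thm. 1.2 is SILENT on every 𝒮⁻-tower, stated on the Legendre symbols.** For `(p₀, q) ∈ 𝒮⁻` (`p₀ ≡ 5 (mod 8)`, `q ≡ 3 (mod 4)`,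
`(p₀/q) = −1`) and distinct primes `p₁, …, p_m ≡ 5 (mod 8)` with `(pᵢ/q) = (pᵢ/p₀) = (pⱼ/pᵢ) = +1`: the printed second genus sum of
`n = 2·q·p₀·p₁⋯p_m` is EVEN. Modulo Rédei–Reichardt (a tree theorem) only; nothing asserted.
[cite: TianYuanZhang2017, Thm. 1.2 (p0002 L115–L127)] [cite: IrelandRosen1990, Ch. 5 §2 Thm. 2] [cite: LiMa2008, Thm. 0.4] -/
theorem even_genusSum₂'_sminus_tower :
    ∀ (m p₀ q : ℕ) (p : Fin m → ℕ), p₀.Prime → q.Prime → p₀ % 8 = 5 → q % 4 = 3 → jacobiSym p₀ q = -1 →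
      (∀ i, (p i).Prime) → (∀ i, p i % 8 = 5) → Function.Injective p →
      (∀ i, jacobiSym (p i) q = 1) → (∀ i, jacobiSym (p i) p₀ = 1) → (∀ i j, i ≠ j → jacobiSym (p j) (p i) = 1) →
      Even (genusSum₂' (2 * (q * (p₀ * ∏ i, p i))) fun d => genusClassNumber (GenusField d)) := by
  intro m p₀ q p hp₀ hq h₀ hq4 hmark hp hp5 hinj hq1 hres hQR
  have hq2 : q ≠ 2 := by omega
  have hprod : p₀ * ∏ i, p i = ∏ i, (vecCons p₀ p : Fin (m + 1) → ℕ) i := by rw [Fin.prod_univ_succ]; simp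
  have hne0 : ∀ i, p i ≠ p₀ := fun i h => by
    have h1 := hres i; rw [h, jacobiSym.mod_left] at h1
    simp [jacobiSym.zero_left hp₀.one_lt] at h1
  have hneq : ∀ i, (vecCons p₀ p : Fin (m + 1) → ℕ) i ≠ q := fun i =>
    Fin.cases (by simp; omega) (fun j => by simp; have := hp5 j; omega) i
  have hPp : ∀ i, ((vecCons p₀ p : Fin (m + 1) → ℕ) i).Prime :=
    fun i => Fin.cases (by simpa using hp₀) (fun j => by simpa using hp j) i
  have hP5 : ∀ i, (vecCons p₀ p : Fin (m + 1) → ℕ) i % 8 = 5 :=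
    fun i => Fin.cases (by simpa using h₀) (fun j => by simpa using hp5 j) i
  have hPinj : Function.Injective (vecCons p₀ p : Fin (m + 1) → ℕ) := by
    have h : Function.Injective (Fin.cons p₀ p : Fin (m + 1) → ℕ) := by
      rw [Fin.cons_injective_iff]
      exact ⟨by rintro ⟨i, hi⟩; exact hne0 i hi, hinj⟩
    exact h
  have hbit1 : ∀ {x y : ℕ}, x.Prime → y.Prime → y ≠ 2 → x ≠ y → jacobiSym x y = 1 → kroneckerBit x y = 0 :=
    fun hx hy hy2 hxy h => (kroneckerBit_of_jacobiSym hx hy hy2 hxy).1 h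
  have hPQR : ∀ i j : Fin (m + 1), i ≠ j →
      kroneckerBit ((vecCons p₀ p : Fin (m + 1) → ℕ) j) ((vecCons p₀ p : Fin (m + 1) → ℕ) i) = 0 := by
    intro i j hij
    refine hbit1 (hPp j) (hPp i) (by have := hP5 i; omega) (fun h => hij.symm (hPinj h)) ?_
    induction i using Fin.cases with
    | zero =>
      induction j using Fin.cases with
      | zero => exact absurd rfl hij
      | succ j' => simpa using hres j'
    | succ i' =>
      induction j using Fin.cases with
      | zero =>
        simp only [cons_val_zero, cons_val_succ]
        rw [jacobiSym.quadratic_reciprocity_one_mod_four (by omega) ((hp i').odd_of_ne_two (by have := hp5 i'; omega))]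
        exact hres i'
      | succ j' =>
        simp only [cons_val_succ]
        exact hQR i' j' fun h => hij (by rw [h])
  have ha : kroneckerBit ((vecCons p₀ p : Fin (m + 1) → ℕ) 0) q = 1 := by
    simpa using (kroneckerBit_of_jacobiSym hp₀ hq hq2 (by omega)).2 hmark
  have ha1 : ∀ i : Fin (m + 1), kroneckerBit ((vecCons p₀ p : Fin (m + 1) → ℕ) i) q = 1 → i = 0 := by
    intro i hi
    induction i using Fin.cases with
    | zero => rfl
    | succ j =>
      exfalso
      have h0 : kroneckerBit ((vecCons p₀ p : Fin (m + 1) → ℕ) j.succ) q = 0 := by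
        simp only [cons_val_succ]
        exact hbit1 (hp j) hq hq2 (fun h => by have := hp5 j; omega) (hq1 j)
      rw [h0] at hi
      exact zero_ne_one hi
  have hsil := even_genusSum₂'_tower hq hq4 hPp hP5 hPinj hPQR ha ha1
  rwa [← hprod] at hsil

/-- **THE 𝒮⁻-TOWER THEOREM with the silence of print made explicit.** For `(p₀, q) ∈ 𝒮⁻` and further distinct primes `p₁, …, p_m ≡ 5 (mod 8)`
(`m ≥ 0`) that are quadratic residues of `q`, of `p₀` and of each other, with `n = 2·q·p₀·p₁⋯p_m`: Tian–Yuan–Zhang's printed second genus sum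
`Σ₂′(n)` is EVEN (their Thm. 1.2 / Cor. 1.4 and Tian 2014 Thm. 1.3 / 5.2 are silent on `n`), AND `ord_{s=1} L(E_n, s) = 1`, rank `E_n(ℚ) = 1`,
`Ш(E_n)[2^∞] = 0`, `BSD(E_n, 2)`. Relative to {`tyz_cmPointGaloisData`, `thm11_parity_of_scriptL`, `rank_eq_analyticRank_of_analyticRank_le_one`,
`monsky_card_selmerGroup_two_even`} (the silence clause modulo Rédei–Reichardt only); nothing asserted; no class booked; NOT refereed.
[cite: Monsky1990MockHeegner, p. 67 Remark (3)] [cite: TianYuanZhang2017, Thm. 1.2 (p0002 L115–L127), §1 (1.1), Thm. 3.5]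
[cite: HeathBrown1994SelmerCongruentII, Appendix (Monsky), typescript p. 41 L20–L36] -/
theorem silent_and_bsdp_two_sminus_tower (hCM : tyz_cmPointGaloisData) (hGZK : rank_eq_analyticRank_of_analyticRank_le_one)
    (hMe : monsky_card_selmerGroup_two_even) (h11 : thm11_parity_of_scriptL) :
    ∀ (m p₀ q : ℕ) (p : Fin m → ℕ), p₀.Prime → q.Prime → p₀ % 8 = 5 → q % 4 = 3 → jacobiSym p₀ q = -1 →
      (∀ i, (p i).Prime) → (∀ i, p i % 8 = 5) → Function.Injective p →
      (∀ i, jacobiSym (p i) q = 1) → (∀ i, jacobiSym (p i) p₀ = 1) → (∀ i j, i ≠ j → jacobiSym (p j) (p i) = 1) →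
      Even (genusSum₂' (2 * (q * (p₀ * ∏ i, p i))) fun d => genusClassNumber (GenusField d)) ∧
        (congruentNumberCurve (2 * (q * (p₀ * ∏ i, p i)))).analyticRank = 1 ∧
        (congruentNumberCurve (2 * (q * (p₀ * ∏ i, p i)))).mordellWeilRank = 1 ∧
        AddCommGroup.primaryComponent (congruentNumberCurve (2 * (q * (p₀ * ∏ i, p i)))).sha 2 = ⊥ ∧
        BSDp (congruentNumberCurve (2 * (q * (p₀ * ∏ i, p i)))) 2 :=
  fun m p₀ q p hp₀ hq h₀ hq4 hmark hp hp5 hinj hq1 hres hQR =>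
    ⟨even_genusSum₂'_sminus_tower m p₀ q p hp₀ hq h₀ hq4 hmark hp hp5 hinj hq1 hres hQR,
      rankOne_sha_bsdp_two_sminus_tower hCM hGZK hMe h11 m p₀ q p hp₀ hq h₀ hq4 hmark hp hp5 hinj hq1 hres hQR⟩

end ThetaDescent

end Summit.BirchSwinnertonDyer.Rank1Residual.P2

end
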